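import Mathlib
import Summits.PneNP.PneNP.Theorems.AeaCutRectanglesDutyRectangles
import Summits.PneNP.PneNP.Theorems.AeaCutRectanglesDutyTransport
import Summits.PneNP.PneNP.Theorems.AeaCutRectanglesCriticalSupport

/-!
# Toft seams on rigid bases — crux `FoolingMeasure` (X1, stmt-PneNP-19727), seat pnp-ideate-p4 g14

FRONTIER restricted-model rung (AEA cut rectangles, route `AeaCutRectangles`); nothing here bears on `P` versus `NP`.
Companion memo: `Cruxes/FoolingMeasure/BarrierNotesP4g14.md` (proofs of the statements typed below as `Prop`s).

g13 (`TypeFloor.lean`) reduced every measure-free kill of X1 to the TYPE FLOOR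
`RobustTypeBound T ∧ T n ≤ 2^{κn}` («few isomorphism types of bisection-robust 4-critical graphs») and left the
dichotomy (α) few types / (β) many types open, with the question «is there ANY non-vertex-transitive robust 4-critical
construction?».  This file types the g14 answer:

* §1 `UniquelyColorable`, `SeamRigidity` — SEAM RIGIDITY THEOREM (memo §1, elementary, proved there; machine-confirmed
  exhaustively for `C(13;1,5)`, `C(97;1,11,38)` and by the explicit formula on every edge class of `C(2419)`, `C(12025)`,
  `W₂₀(477691)`): if `W = Cay(ℤₙ, ±S)` (`1 ∈ S`) has no proper 3-colouring, then for every edge `e₀ = {u, u+s₀}` with `s₀`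
  a unit, `W − e₀` has AT MOST ONE proper 3-colouring up to the six colour permutations, given by an explicit `±1` word.
  Consequence: the FROZEN CLASS of `u` in `W − e₀` is a full colour class (`⌈n/3⌉` vertices: 807, 4009, 159231).
* §2 `toftSeam`, `toftSeam_not_colorable` (PROVED): glue an odd cycle `C_M` to a graph `G` along `f : Fin M → V(G)`;
  if every 3-colouring of `G` is constant on `range f`, the seam graph is not 3-colourable.
* §3 `IsFourCritical`, `ToftSeamCritical` — Toft's splitting theorem (Toft 1974a; Handbook of Combinatorics ch. 4 Thm 2.5
  (b)(iii), p. 245) specialised to `k = 4`, hub of an odd wheel split into the frozen set `A = range f` of `G − e₀`: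
  the seam graph is 4-critical.  A published theorem, used as a named hypothesis.
* §4 `seamRobust_arith` (PROVED arithmetic core of the robustness transfer, memo §2.2) and the typed
  conclusion `SeamTypeExplosion` (memo §2.3–§3): from ONE robust rigid base on `n` vertices with margin `> 21M` one gets
  `≥ M!/(4M)` pairwise non-isomorphic bisection-robust 4-critical graphs on `n + M` vertices; along any infinite base family
  with linear margin this is `N^{Ω(N)}` types, i.e. `RobustTypeBound T` fails for every `T n ≤ 2^{κn}` — inversion (α) of
  g13 is dead in substance, the dichotomy resolves to (β).
* §5 `RigidCoreLocalization` — the lens output: the kill-side statement typed JUST OUTSIDE the new construction class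
  (all superexponential entropy of the seam families sits on `o(n)` vertices of degree `3` glued to a uniquely-colourable
  core), recorded as the g15 target with its why-might-fail.
-/

set_option linter.dupNamespace false
set_option autoImplicit false

namespace Summit.PneNP.PneNP.Cruxes.FoolingMeasure.P4g14

open Finset SimpleGraph
open Summit.PneNP.PneNP.Theorems.AeaCutRectanglesDutyRectangles (bobSide)
open Summit.PneNP.PneNP.Theorems.AeaCutRectanglesDutyTransport (relabel relabel_symm_relabel)
open Summit.PneNP.PneNP.Theorems.AeaCutRectanglesCriticalSupport (IsEdgeCritical)

/-! ## §1 Unique colourability and the Seam Rigidity statement -/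

/-- `G` is uniquely `k`-colourable in the weak sense used here: any two proper `k`-colourings differ by a permutation of
the colours (no existence claimed). -/
def UniquelyColorable {V : Type*} (G : SimpleGraph V) (k : ℕ) : Prop :=
  ∀ C₁ C₂ : G.Coloring (Fin k), ∃ π : Equiv.Perm (Fin k), ∀ v, C₂ v = π (C₁ v)

/-- In a uniquely colourable graph the colour classes are frozen: two vertices coloured alike by one proper colouring are
coloured alike by every proper colouring. -/
theorem frozen_of_uniquelyColorable {V : Type*} {G : SimpleGraph V} {k : ℕ} (h : UniquelyColorable G k)
    (C₁ C₂ : G.Coloring (Fin k)) (u v : V) (huv : C₁ u = C₁ v) : C₂ u = C₂ v := by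
  obtain ⟨π, hπ⟩ := h C₁ C₂
  rw [hπ u, hπ v, huv]

/-- **SEAM RIGIDITY** (memo §1, proved there by the `±1`-word / sliding-window argument behind the cell's `R3T`):
a circulant `W = Cay(ℤₙ, S ∪ −S)` with `1 ∈ S` and NO proper 3-colouring becomes uniquely 3-colourable (in the sense of
`UniquelyColorable`: at most one colouring up to `S₃`) after deleting any single edge `{0, s₀}` with `s₀ ∈ S` a unit,
`s₀ ≠ ±1`.  (For `s₀ = ±1` relabel through another unit generator.)  Typed as a `Prop`; its Lean proof is not in this file. -/
def SeamRigidity : Prop :=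
  ∀ (n : ℕ) [NeZero n] (S : Finset (ZMod n)), (1 : ZMod n) ∈ S → (0 : ZMod n) ∉ S →
    ¬ (circulantGraph (S : Set (ZMod n))).Colorable 3 →
    ∀ s₀ ∈ S, IsUnit s₀ → s₀ ≠ 1 → s₀ ≠ -1 →
      UniquelyColorable ((circulantGraph (S : Set (ZMod n))).deleteEdges {s((0 : ZMod n), s₀)}) 3

/-- The explicit seam word (memo §1): with `k = s₀⁻¹ (mod n)`, `w i = +1` iff `i ∈ {j·s₀ : 1 ≤ j ≤ k}`, else `−1`;
the colouring is `c x = w 1 + ⋯ + w x (mod 3)`.  Here as a computable function on `Fin n` (values in `ZMod 3`). -/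
def seamPlus (n : ℕ) (s₀ k : ℕ) : Finset ℕ := (Finset.Icc 1 k).image fun j => j * s₀ % n

/-- the seam colouring `c x = ∑_{1 ≤ i ≤ x} w i (mod 3)` (`w i = 1` on `seamPlus`, `w i = 2 ≡ −1` otherwise). -/
def seamColour (n s₀ k : ℕ) (x : ℕ) : ZMod 3 :=
  ∑ i ∈ Finset.Icc 1 x, (if i ∈ seamPlus n s₀ k then (1 : ZMod 3) else 2)

/-- Sanity instance (kernel-checked): for `W = C(13; ±{1,5})` (no proper 3-colouring: `R3T`/brute force) and `e₀ = {0,5}`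
(`k = 5⁻¹ = 8 (mod 13)`), the seam colouring is PROPER on `W − e₀` and improper exactly at `e₀`:
for every `x` and `d ∈ {1, 5}`, `c x = c (x + d)` happens only for `(x, d) = (0, 5)`. -/
example : ∀ x : Fin 13, ∀ d ∈ ({1, 5} : Finset ℕ),
    (seamColour 13 5 8 x.val = seamColour 13 5 8 ((x.val + d) % 13) ↔ (x.val = 0 ∧ d = 5)) := by
  decide

/-- … and the seam word integrates around the cycle (`c 12 + w 0 = c 0`, i.e. `2P − n ≡ 0 (mod 3)` with `P = 8`). -/
example : seamColour 13 5 8 12 + 2 = seamColour 13 5 8 0 := by decide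

/-! ## §2 The Toft seam and its darkness (proved) -/

/-- The TOFT SEAM of `G` along `f : Fin M → V`: the disjoint union of `G` and the cycle `C_M`, plus the matching-like
edges `f i — i`.  (Toft's «proper splitting» of the hub of the odd wheel `W_M` into the set `A = range f`, followed by the
removal of the hyperedge `A`; memo §2.1.) -/
def seamRel {V : Type*} (G : SimpleGraph V) (M : ℕ) (f : Fin M → V) : V ⊕ Fin M → V ⊕ Fin M → Prop
  | .inl x, .inl y => G.Adj x y
  | .inr i, .inr j => (cycleGraph M).Adj i j
  | .inl x, .inr i => f i = x
  | .inr _, .inl _ => False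

/-- the seam graph `G ⊔ C_M + {f i ~ i}` on `V ⊕ Fin M`. -/
def toftSeam {V : Type*} (G : SimpleGraph V) (M : ℕ) (f : Fin M → V) : SimpleGraph (V ⊕ Fin M) :=
  SimpleGraph.fromRel (seamRel G M f)

theorem toftSeam_adj_inl {V : Type*} (G : SimpleGraph V) (M : ℕ) (f : Fin M → V) (x y : V) :
    (toftSeam G M f).Adj (.inl x) (.inl y) ↔ G.Adj x y := by
  simp only [toftSeam, SimpleGraph.fromRel_adj, seamRel, ne_eq, Sum.inl.injEq]
  constructor
  · rintro ⟨-, h | h⟩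
    · exact h
    · exact h.symm
  · intro h
    exact ⟨h.ne, Or.inl h⟩

theorem toftSeam_adj_inr {V : Type*} (G : SimpleGraph V) (M : ℕ) (f : Fin M → V) (i j : Fin M) :
    (toftSeam G M f).Adj (.inr i) (.inr j) ↔ (cycleGraph M).Adj i j := by
  simp only [toftSeam, SimpleGraph.fromRel_adj, seamRel, ne_eq, Sum.inr.injEq]
  constructor
  · rintro ⟨-, h | h⟩
    · exact h
    · exact h.symm
  · intro h
    exact ⟨h.ne, Or.inl h⟩

theorem toftSeam_adj_attach {V : Type*} (G : SimpleGraph V) (M : ℕ) (f : Fin M → V) (i : Fin M) :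
    (toftSeam G M f).Adj (.inl (f i)) (.inr i) := by
  rw [toftSeam, SimpleGraph.fromRel_adj]
  exact ⟨Sum.inl_ne_inr, Or.inl rfl⟩

/-- the base embeds in the seam as a subgraph (graph homomorphism `inl`). -/
def inlHom {V : Type*} (G : SimpleGraph V) (M : ℕ) (f : Fin M → V) : G →g toftSeam G M f where
  toFun := Sum.inl
  map_rel' := fun {x y} h => (toftSeam_adj_inl G M f x y).2 h

/-- the rim embeds in the seam as a subgraph (graph homomorphism `inr`). -/
def inrHom {V : Type*} (G : SimpleGraph V) (M : ℕ) (f : Fin M → V) : cycleGraph M →g toftSeam G M f where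
  toFun := Sum.inr
  map_rel' := fun {i j} h => (toftSeam_adj_inr G M f i j).2 h

/-- in `Fin 3`, avoiding two distinct values pins the third. -/
theorem fin3_eq_of_ne_of_ne : ∀ a t : Fin 3, a ≠ t → a ≠ t + 1 → a = t + 2 := by decide

/-- an odd cycle of length `≥ 3` is not 2-colourable (from Mathlib's `chromaticNumber_cycleGraph_of_odd`). -/
theorem cycleGraph_not_colorable_two {M : ℕ} (hM : Odd M) (h3 : 3 ≤ M) : ¬ (cycleGraph M).Colorable 2 := by
  intro h
  have h1 := h.chromaticNumber_le
  rw [SimpleGraph.chromaticNumber_cycleGraph_of_odd M (by omega) hM] at h1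
  norm_num at h1

/-- **DARKNESS OF THE SEAM** (memo §2.1, = Toft's Thm 2.5 (a) in this configuration): if `M ≥ 3` is odd and every proper
3-colouring of `G` is constant on the attachment set `range f`, then the Toft seam `G ⊔ C_M + {f i ~ i}` has no proper
3-colouring.  (Proof: the base colouring is constant `= t` on `range f`; every rim vertex avoids `t`; so the odd rim is
2-coloured — impossible.) -/
theorem toftSeam_not_colorable {V : Type*} (G : SimpleGraph V) {M : ℕ} (hM : Odd M) (h3 : 3 ≤ M) (f : Fin M → V)
    (hA : ∀ C : G.Coloring (Fin 3), ∀ i j : Fin M, C (f i) = C (f j)) :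
    ¬ (toftSeam G M f).Colorable 3 := by
  rintro ⟨C'⟩
  -- the induced colouring of the base
  let C : G.Coloring (Fin 3) := C'.comp (inlHom G M f)
  have hC : ∀ i : Fin M, C' (.inl (f i)) = C' (.inl (f ⟨0, by omega⟩)) := fun i => hA C i ⟨0, by omega⟩
  set t : Fin 3 := C' (.inl (f ⟨0, by omega⟩)) with ht
  -- rim vertices avoid `t`
  have hrim : ∀ i : Fin M, C' (.inr i) ≠ t := by
    intro i
    have hadj := toftSeam_adj_attach G M f i
    have := C'.valid hadj
    rw [hC i] at this
    exact fun h => this h.symm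
  -- 2-colour the rim by `[colour = t + 1]`
  let D : (cycleGraph M).Coloring Bool :=
    Coloring.mk (fun i => decide (C' (.inr i) = t + 1)) (by
      intro i j hij hD
      have hne : C' (.inr i) ≠ C' (.inr j) := C'.valid ((toftSeam_adj_inr G M f i j).2 hij)
      simp only [decide_eq_decide] at hD
      by_cases hi : C' (.inr i) = t + 1
      · exact hne (hi.trans (hD.1 hi).symm)
      · have hj : C' (.inr j) ≠ t + 1 := fun hj => hi (hD.2 hj)
        exact hne ((fin3_eq_of_ne_of_ne _ _ (hrim i) hi).trans (fin3_eq_of_ne_of_ne _ _ (hrim j) hj).symm))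
  have h2 : (cycleGraph M).Colorable 2 := by
    have := D.colorable
    simpa using this
  exact cycleGraph_not_colorable_two hM h3 h2

/-! ## §3 Four-criticality and Toft's splitting theorem as a named hypothesis -/

/-- `G` is 4-(edge-)critical: no proper 3-colouring, but every single-edge deletion has one.  (For a loopless edge set
`F` on `Fin n` this is the route's `¬ Colorable 3 ∧ IsEdgeCritical` reading of `fromEdgeSet F`.) -/
def IsFourCritical {V : Type*} (G : SimpleGraph V) : Prop :=
  ¬ G.Colorable 3 ∧ ∀ e ∈ G.edgeSet, (G.deleteEdges {e}).Colorable 3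

/-- **TOFT'S SPLITTING THEOREM, odd-wheel case, `k = 4`** (Toft 1974a = B. Toft, *Color-critical graphs and hypergraphs*,
J. Combin. Theory Ser. B 16 (1974) 145–161; quoted as Thm 2.5 (b)(iii) of the Handbook of Combinatorics vol. 1 ch. 4,
p. 245 [corpus:book:graham1996-handbook-combinatorics-vol-1 p0245]) in the seam configuration (memo §2.1):
`G` 4-critical, `e₀ = uv ∈ E(G)`, `A := range f ∋ u, v` FROZEN in `G − e₀` (every proper 3-colouring of `G − e₀` is
constant on `A`), `M ≥ max(3,|A|)` odd.  Then the hypergraph `H = (G − e₀) + A` is 4-critical (memo: (R) + (β)), the odd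
wheel `W_M` is 4-critical with hub of degree `M ≥ |A|`, `f` is a proper splitting of the hub into `A`, and Toft (b)(iii)
says the result — our `toftSeam (G − e₀) M f` — is 4-critical.  A published theorem used BY NAME as a hypothesis
(Literature fact candidate `Literature/Combinatorics/ColourCritical/ToftSplitting`); never an axiom here.  In this configuration
the statement is in fact ELEMENTARY (memo §2.1: rim edge / spoke / base edge, the last by list-colouring the rim from 2-lists that are
not all equal) — a Lean proof is routine future work; darkness is `toftSeam_dark_of_frozen` below. -/
def ToftSeamCritical : Prop :=
  ∀ (V : Type) [Fintype V] [DecidableEq V] (G : SimpleGraph V) (u v : V) (M : ℕ) (f : Fin M → V),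
    IsFourCritical G → G.Adj u v → Odd M → 3 ≤ M → u ∈ Set.range f → v ∈ Set.range f →
    (∀ C : (G.deleteEdges {s(u, v)}).Coloring (Fin 3), ∀ i : Fin M, C (f i) = C u) →
    IsFourCritical (toftSeam (G.deleteEdges {s(u, v)}) M f)

/-- The darkness half of `ToftSeamCritical` needs no citation: it is `toftSeam_not_colorable`. -/
theorem toftSeam_dark_of_frozen {V : Type*} (G : SimpleGraph V) (u v : V) {M : ℕ} (hM : Odd M) (h3 : 3 ≤ M)
    (f : Fin M → V) (hA : ∀ C : (G.deleteEdges {s(u, v)}).Coloring (Fin 3), ∀ i : Fin M, C (f i) = C u) :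
    ¬ (toftSeam (G.deleteEdges {s(u, v)}) M f).Colorable 3 :=
  toftSeam_not_colorable _ hM h3 f fun C i j => (hA C i).trans (hA C j).symm

/-! ## §4 Robustness transfer and the type explosion -/

/-- **ARITHMETIC CORE OF THE ROBUSTNESS TRANSFER** (memo §2.2).  Base `W` on `n` vertices of maximum degree `Δ`
whose every `T` with `2|T| ≥ n` spans `eTX ≥ n/2 + m` edges (margin `m` over the robustness threshold); seam of length
`M` with `(Δ+1)(M+2) < 2m`.  A half `S` of the seam graph (`2|S| ≥ n + M`) meets the base in a set `T` with
`2|T| ≥ n − M`; pad `T` by `p` vertices, `2p ≤ M + 2`, to reach half of the base: the padded set spans `eTX ≥ n/2 + m`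
edges, of which at most `Δ p` touch the padding, and one more base edge (`e₀`) is missing in the seam graph.  Conclusion:
`S` spans `≥ eT − 1 > (n + M)/2` edges — the seam graph is bisection-robust.  (Pure arithmetic; the set bookkeeping is
routine and left to the memo.) -/
theorem seamRobust_arith (n M Δ m eT eTX p : ℕ) (hM : (Δ + 1) * (M + 2) < 2 * m)
    (hpad : eTX ≤ eT + Δ * p) (hp : 2 * p ≤ M + 2) (hTX : n + 2 * m ≤ 2 * eTX) :
    n + M < 2 * (eT - 1) := by
  have h2 : Δ * (2 * p) ≤ Δ * (M + 2) := Nat.mul_le_mul_left Δ hp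
  have h3 : (Δ + 1) * (M + 2) = Δ * (M + 2) + (M + 2) := by ring
  have h4 : Δ * (2 * p) = 2 * (Δ * p) := by ring
  omega

/-- Instance check of the arithmetic with the `W₂₀(477691)` numbers (`Δ = 20`, margin `m = (n+9)/2 = 238850` from
`w20_linearExcess`, seam length `M = 22745`): `21 · 22747 = 477687 < 477700`. -/
example : (20 + 1) * (22745 + 2) < 2 * 238850 := by norm_num

/-- verbatim from g13's `TypeFloor.lean` (`P4g13.BisectionRobustCritical`; that workfile is not importable on the farm):
a BISECTION-ROBUST 4-edge-critical edge set over `Fin n`. -/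
def BisectionRobustCritical {n : ℕ} (F : Finset (Sym2 (Fin n))) : Prop :=
  IsEdgeCritical F ∧ ∀ S : Finset (Fin n), n ≤ 2 * S.card → n < 2 * (bobSide S F).card

/-- verbatim from g13's `TypeFloor.lean` (`P4g13.RobustTypeBound`): at most `T n` isomorphism types of bisection-robust
4-critical edge sets on `Fin n`.  g13: `RobustTypeBound T → (∀ᶠ n, T n ≤ 2^{κn}) → ¬ FoolingMeasure`. -/
def RobustTypeBound (T : ℕ → ℕ) : Prop :=
  ∀ n : ℕ, ∃ 𝓣 : Finset (Finset (Sym2 (Fin n))), 𝓣.card ≤ T n ∧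
    ∀ F : Finset (Sym2 (Fin n)), BisectionRobustCritical F →
      ∃ H ∈ 𝓣, ∃ σ : Equiv.Perm (Fin n), F = relabel σ H

/-- «more than `B` pairwise non-isomorphic bisection-robust 4-critical edge sets on `Fin N`». -/
def ManyRobustTypes (N : ℕ) (B : ℝ) : Prop :=
  ∃ 𝓕 : Finset (Finset (Sym2 (Fin N))), B < 𝓕.card ∧ (∀ F ∈ 𝓕, BisectionRobustCritical F) ∧
    ∀ F ∈ 𝓕, ∀ H ∈ 𝓕, F ≠ H → ∀ σ : Equiv.Perm (Fin N), relabel σ H ≠ F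

/-- relabelling composes. -/
theorem relabel_relabel {N : ℕ} (σ τ : Equiv.Perm (Fin N)) (F : Finset (Sym2 (Fin N))) :
    relabel σ (relabel τ F) = relabel (τ.trans σ) F := by
  simp only [relabel, Finset.image_image]
  congr 1
  funext e
  simp [Sym2.map_map]

/-- **PIGEONHOLE (proved): many types at infinitely many `N` refute every type bound they exceed.**  This is the exact
negation target of g13's kill `foolingMeasure_false_of_fewRobustTypes`: a family as in `ManyRobustTypes N (T N)` for
unboundedly many `N` gives `¬ RobustTypeBound T`. -/
theorem not_robustTypeBound_of_manyTypes {T : ℕ → ℕ} (h : ∀ N₀ : ℕ, ∃ N ≥ N₀, ManyRobustTypes N (T N)) :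
    ¬ RobustTypeBound T := by
  intro hT
  obtain ⟨N, -, 𝓕, hcard, hrob, hiso⟩ := h 0
  obtain ⟨𝓣, h𝓣, hcover⟩ := hT N
  choose! rep hrep σ hσ using hcover
  have hlt : 𝓣.card < 𝓕.card := by
    have : (𝓣.card : ℝ) < 𝓕.card := lt_of_le_of_lt (by exact_mod_cast h𝓣) hcard
    exact_mod_cast this
  obtain ⟨F, hF, F', hF', hne, hEq⟩ :=
    Finset.exists_ne_map_eq_of_card_lt_of_maps_to hlt (f := rep) fun F hF => hrep F (hrob F hF)
  have h1 : F = relabel (σ F) (rep F) := hσ F (hrob F hF)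
  have h2 : F' = relabel (σ F') (rep F') := hσ F' (hrob F' hF')
  have h3 : relabel (σ F').symm (relabel (σ F') (rep F')) = rep F' := relabel_symm_relabel (σ F') (rep F')
  rw [← h2] at h3
  refine hiso F hF F' hF' hne ((σ F').symm.trans (σ F)) ?_
  rw [← relabel_relabel, h3, ← hEq, ← h1]

/-- THE BASE FAMILY HYPOTHESIS (memo §3.2): for infinitely many `n` there is a connection set `S ∋ 1` of units,
`|S| ≤ 10` (degree `≤ 20`), such that `W = Cay(ℤₙ, S ∪ −S)` is 4-critical and every vertex set `T` with `2|T| ≥ n` spans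
MORE THAN `n` edges of `W` (margin `> n/2` over the robustness threshold — LINEAR).  Witnessed at `n = 477691`:
`Theorems/AeaCutRectanglesW20LinearExcess.lean` (`w20_linearExcess`, kernel-checked) for the density, the cell's
no-middle-third scan + `R3T` for darkness and the seam words of kit j321107 for criticality of all ten edge classes; further
members in `CYCLO-CENSUS.md` (coset-pentagon circulants up to `3.75·10⁶`).  OPEN as an infinitude statement
(number theory of near-miss multipliers); this is the ONLY unproved number-theoretic input of `SeamTypeExplosion`. -/
def RigidRobustBases : Prop :=
  ∀ n₀ : ℕ, ∃ n ≥ n₀, ∃ _ : NeZero n, ∃ S : Finset (ZMod n), (1 : ZMod n) ∈ S ∧ (0 : ZMod n) ∉ S ∧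
    (∀ s ∈ S, IsUnit s) ∧ S.card ≤ 10 ∧ IsFourCritical (circulantGraph (S : Set (ZMod n))) ∧
      ∀ T : Finset (ZMod n), n ≤ 2 * T.card →
        n < ((circulantGraph (S : Set (ZMod n))).edgeFinset.filter fun e => ∀ x ∈ e, x ∈ T).card

/-- **SEAM TYPE EXPLOSION — the typed conclusion** (memo §3, Theorem 3; proof there from `SeamRigidity` (frozen class =
a colour class of size `⌈n/3⌉`), `ToftSeamCritical` (criticality), `seamRobust_arith` (robustness for `21(M+2) < n + 9`),
the degree argument `Aut(seam) ↪ Aut(W)_{e₀}` with the individualisation certificates of kit j321107 (`|Aut(W)_{e₀}| ≤ 2`),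
and `not_robustTypeBound_of_manyTypes`): seams of length `M ~ n/21` over the rigid robust bases give `≥ M!/(4M)`
pairwise non-isomorphic bisection-robust 4-critical graphs on `N = n + M` vertices, i.e. `N^{(1/22 − o(1))N} > 2^{κN}`
types for every `κ` and all large members of the family.  Hence g13's type floor fails for EVERY `T n ≤ 2^{κn}`:
inversion (α) is dead (conditionally on `RigidRobustBases` only), the dichotomy resolves to (β). -/
def SeamTypeExplosion : Prop :=
  SeamRigidity → ToftSeamCritical → RigidRobustBases →
    ∀ κ : ℝ, ∀ T : ℕ → ℕ, (∀ᶠ n : ℕ in Filter.atTop, (T n : ℝ) ≤ (2 : ℝ) ^ (κ * n)) → ¬ RobustTypeBound T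

/-! ## §5 The inversion typed just outside the new class (g15 target) -/

/-- **RIGID-CORE LOCALIZATION** (memo §5; the lens output).  The seam families carry all their superexponential entropy on
`M = o(n)`… in fact `M ≤ n/21` vertices of degree `3` attached to a UNIQUELY 3-colourable core that is one FIXED graph up to
relabelling.  The kill-side statement just outside this class: every bisection-robust 4-critical graph splits as
CORE ⊔ FRINGE with (i) the core drawn from a family of at most `2^{κ n}` isomorphism types, (ii) the fringe of size
`≤ δ n`, and (iii) every proper 3-colouring of CORE extending to at most … — we type only (i)+(ii), the part a rectangle
refuter would use («guess the core type, pay `2^{κn}`; the fringe costs `≤ n^{δn}`»).  WHY IT MIGHT FAIL: two seams glued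
rim-to-rim, or seams on seams (memo §3.4: the seam graph is again rigid off the rim?) iterate to fringes of linear size
with `δ → 1`; and nothing forces a generic robust 4-critical graph to have ANY uniquely-colourable core. -/
def RigidCoreLocalization (κ δ : ℝ) : Prop :=
  ∀ᶠ N : ℕ in Filter.atTop, ∃ 𝓒 : Finset (Finset (Sym2 (Fin N))), (𝓒.card : ℝ) ≤ (2 : ℝ) ^ (κ * N) ∧
    ∀ F : Finset (Sym2 (Fin N)), BisectionRobustCritical F →
      ∃ C ∈ 𝓒, ∃ σ : Equiv.Perm (Fin N), ∃ R : Finset (Fin N), (R.card : ℝ) ≤ δ * N ∧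
        ∀ e, e ∈ F ∧ (∀ x ∈ e, x ∉ R) ↔ e ∈ relabel σ C ∧ (∀ x ∈ e, x ∉ R)

/-- Bookkeeping (proved): localization with `δ = 0`-fringe… more precisely, if the fringe is empty the core IS the graph,
so `RigidCoreLocalization κ 0` is exactly a type floor `2^{κN}` — the g13 statement this generation kills in substance.
We record the trivial direction: few types ⇒ localization with empty fringe. -/
theorem rigidCoreLocalization_of_fewTypes (κ : ℝ)
    (h : ∀ᶠ N : ℕ in Filter.atTop, ∃ 𝓒 : Finset (Finset (Sym2 (Fin N))), (𝓒.card : ℝ) ≤ (2 : ℝ) ^ (κ * N) ∧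
      ∀ F : Finset (Sym2 (Fin N)), BisectionRobustCritical F → ∃ C ∈ 𝓒, ∃ σ : Equiv.Perm (Fin N), F = relabel σ C) :
    RigidCoreLocalization κ 0 := by
  filter_upwards [h] with N hN
  obtain ⟨𝓒, hcard, hF⟩ := hN
  refine ⟨𝓒, hcard, fun F hR => ?_⟩
  obtain ⟨C, hC, σ, rfl⟩ := hF F hR
  refine ⟨C, hC, σ, ∅, by simp, fun e => ?_⟩
  simp

end Summit.PneNP.PneNP.Cruxes.FoolingMeasure.P4g14
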